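import Summits.QuantumFields.BalabanUV.T4Continuum.Support.NE7EtaSupFromEnergy

/-!
# NE7EtaSupFromEnergyTorus — sequel of `NE7EtaSupFromEnergy` (route #1 of the NE7 crux, stubs S1∕L7b and S2): the pointwise bounds
# EVERYWHERE on the period torus, and the cube-side optimisation IN THE KERNEL (`d = 4`: `sup ≤ 2·(8λ′)^{2/3}·E^{1/3}`)

Cell `pub-balaban`, rung (B)+1 sub-cell t4, lineage `b2b-balaban-t4-ne7-p1`, generation 21 (CRUX PROVER NE7 #1, ruling e34b3e0c);
crux skeleton `t4/skeletons/NE7-CRUX-R1.md` v1.5 §3bis.  HONEST FRAMING (page 1): FIXED FINITE T⁴, rung (B)+1; NE7, NE3 NOT PRINTED in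
[Balaban1984PropagatorsI]–[Balaban1989LargeFieldII] and NOT PROVED here; continuum YM on T⁴ ⇐ BetaPertH ∧ nine spine estimates
(0/9 proved); BetaPertH ⇐ (D1) ∧ (D4) ∧ CAP+tail; G-an2-4 gates asym, D1 and NE2/3/4; NOT infinite volume, NOT mass gap, NOT Clay.

WHAT.  `NE7EtaSupFromEnergy` bounds the two-run discrepancy direction `Z` and its dressed curl `d_W Z` POINTWISE by
`2d·r·λ + (scale)·E∕√((r+1)^d)` on any cube of side `r` inside the summation domain `F`, with `E = energyNormW L k W Z F` and `r` free
(«the consumer optimises»).  This sequel removes both provisos for the cell's data (periodic configurations on the period box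
`periodBox (N L^k)`, `d = 4`):
 * §1 PERIODIC PLUMBING — `sum_Icc_le_sum_periodBox` (a cube of side `r ≤ P − 1` anchored ANYWHERE sums a non-negative `P`-periodic
   function to at most its period-box sum: the cube lies in a translate of the box, `T4AveragingDeficitWallBoundary.sum_periodBox_shift`),
   `curl_add_period`, `energyNormW_Icc_le_periodBox`, and the two bounds for EVERY site: `norm_dir_le_of_energyNormW_periodic`,
   `norm_curl_le_of_energyNormW_periodic` (energy norm of ONE period box on the right);
 * §2 THE OPTIMISATION — `exists_side_two_term` (for `a, b > 0` some natural `r` has `r + 1 < b∕a + 1` and `a³r + b³∕(r+1)² ≤ 2a²b`;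
   cube-root-free form of `A·r + B∕(r+1)² ≤ 2A^{2/3}B^{1/3}`), `sqrt_pow_four`, and at `d = 4` the OPTIMISED SUP BOUNDS
   **`norm_curl_le_opt_d4`** (`‖(d_W Z)(x₀, π)‖ ≤ 2a²b` for all `x₀`, where `a³ = 8λ′`, `b³ = E`, provided the optimal cube fits:
   `b∕a + 1 ≤ P`) and **`norm_dir_le_opt_d4`** (`‖Z x₀ κ‖ ≤ 2a²b`, `a³ = 8λ`, `b³ = L^k·E`).
EXPONENT COUNT now a kernel display: with `λ′ = Λ₂ξ³` and `E ≤ C·residualScale ≈ cN²√g·ξ` (NE3's T-E_w, `d = 4`, `ξ = L^{−k}`),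
`a = 2Λ₂^{1/3}ξ`, `b = (cN²√g)^{1/3}ξ^{1/3}`, so `sup‖d_W Z‖ ≤ 8Λ₂^{2/3}(cN²√g)^{1/3}·ξ^{2+1/3}` — one third of a power of `ξ` below
the (1.15) margin `βα₀(g_k)ξ²`: route #1's U-slot closeness at GEOMETRIC rate `L^{−1/3}` per step (times the poly∕log loss of
`α₀(g_k)`), from the ENERGY conjunct + the step-Lipschitz conjunct; the fit condition `b∕a + 1 ≤ N L^k` reads
`(cN²√g∕(8Λ₂))^{1/3}·L^{2k/3} + 1 ≤ N L^k`, true for all large `k`.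
HONEST.  Elementary lattice bookkeeping ([folklore]); the Lipschitz constants and T-E_w are HYPOTHESES (row NE3's, re-typed INTERFACE
REQUEST NE7→NE3 of skeleton v1.5 §4); nothing of NE3∕NE7 discharged; 0 def, 0 sorry; nothing printed is a hypothesis of a theorem.
-/

set_option autoImplicit false

open scoped BigOperators Matrix Matrix.Norms.L2Operator
open Finset

namespace Summit.QuantumFields.BalabanUV.T4Continuum.NE7EtaSupFromEnergyTorus

open Literature.MathematicalPhysics.QuantumFieldTheory.Balaban1983to89
open B7Prop1Explicit B7Prop2Explicit
open T4AveragingDeficitWall hiding Site Plane Plaq Bond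
open T4AveragingDeficitWallBoundary (periodBox mem_periodBox sum_periodBox_shift IsPeriodicCfg)
open AveragingDeficitPeriodicCounting (IsPeriodicDir)
open NE3EnergyWeightedShapes (energyNormW energyNormW_nonneg)
open NE7EtaSupFromEnergy (norm_dir_le_of_energyNormW norm_curl_le_of_energyNormW)

noncomputable section

/-! ## §1 PERIODIC PLUMBING: on the period torus every site has a cube, so the pointwise bounds hold EVERYWHERE with
the energy norm of ONE period box; cube side `r ≤ P − 1` free -/

section Periodic

variable {d : ℕ} {n : Type*} [Fintype n] [DecidableEq n]

/-- A cube of side `r ≤ P − 1` anchored anywhere sums a non-negative `P`-periodic function to at most its period-box sum. [folklore] -/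
theorem sum_Icc_le_sum_periodBox {P : ℕ} (hP : 1 ≤ P) {g : Site d → ℝ} (hg0 : ∀ x, 0 ≤ g x)
    (hg : ∀ (x : Site d) (κ : Fin d), g (x + (P : ℤ) • e κ) = g x) (y₀ : Site d) {r : ℕ} (hr : r + 1 ≤ P) :
    ∑ x ∈ Finset.Icc y₀ (y₀ + fun _ => (r : ℤ)), g x ≤ ∑ x ∈ periodBox (d := d) P, g x := by
  classical
  have hsub : Finset.Icc y₀ (y₀ + fun _ => (r : ℤ)) ⊆ (periodBox (d := d) P).image (fun v => v + y₀) := by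
    intro x hx
    rw [Finset.mem_Icc] at hx
    obtain ⟨hlo, hhi⟩ := hx
    refine Finset.mem_image.mpr ⟨x - y₀, mem_periodBox.mpr fun κ => ?_, by abel⟩
    have h1 : y₀ κ ≤ x κ := hlo κ
    have h2 : x κ ≤ y₀ κ + (r : ℤ) := hhi κ
    have hrP : (r : ℤ) + 1 ≤ (P : ℤ) := by exact_mod_cast hr
    show 0 ≤ x κ - y₀ κ ∧ x κ - y₀ κ < (P : ℤ)
    constructor <;> omega
  have hinj : Set.InjOn (fun v : Site d => v + y₀) ↑(periodBox (d := d) P) := fun v _ v' _ h => add_right_cancel h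
  calc ∑ x ∈ Finset.Icc y₀ (y₀ + fun _ => (r : ℤ)), g x
      ≤ ∑ x ∈ (periodBox (d := d) P).image (fun v => v + y₀), g x :=
        Finset.sum_le_sum_of_subset_of_nonneg hsub fun x _ _ => hg0 x
    _ = ∑ v ∈ periodBox (d := d) P, g (v + y₀) := Finset.sum_image hinj
    _ = ∑ x ∈ periodBox (d := d) P, g x := sum_periodBox_shift P hP hg y₀

/-- The dressed curl of periodic data is periodic. [folklore] -/
theorem curl_add_period {W : Site d → Fin d → (Matrix n n ℂ)ˣ} {Z : Site d → Fin d → Matrix n n ℂ} {P : ℤ}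
    (hW : IsPeriodicCfg W P) (hZ : IsPeriodicDir Z P) (x : Site d) (κ : Fin d) (π : T4AveragingDeficitWall.Plane d) :
    curl W Z (x + P • e κ, π) = curl W Z (x, π) := by
  have hW' : ∀ (y : Site d) (μ : Fin d), W (y + P • e κ) μ = W y μ := fun y μ => hW y κ μ
  have hZ' : ∀ (y : Site d) (μ : Fin d), Z (y + P • e κ) μ = Z y μ := fun y μ => hZ y κ μ
  simp only [curl, curlAt, add_right_comm _ (P • e κ), hW', hZ']

/-- The energy norm over any cube of side `r ≤ P − 1` is at most the energy norm over the period box (periodic data). [folklore] -/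
theorem energyNormW_Icc_le_periodBox (L k : ℕ) {P : ℕ} (hP : 1 ≤ P) {W : Site d → Fin d → (Matrix n n ℂ)ˣ}
    {Z : Site d → Fin d → Matrix n n ℂ} (hW : IsPeriodicCfg W (P : ℤ)) (hZ : IsPeriodicDir Z (P : ℤ)) (y₀ : Site d) {r : ℕ}
    (hr : r + 1 ≤ P) :
    energyNormW L k W Z (Finset.Icc y₀ (y₀ + fun _ => (r : ℤ))) ≤ energyNormW L k W Z (periodBox (d := d) P) := by
  unfold energyNormW
  apply Real.sqrt_le_sqrt
  have hc : curlSq W Z (Finset.Icc y₀ (y₀ + fun _ => (r : ℤ))) ≤ curlSq W Z (periodBox (d := d) P) := by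
    unfold curlSq
    exact sum_Icc_le_sum_periodBox hP (fun x => Finset.sum_nonneg fun _ _ => sq_nonneg _)
      (fun x κ => Finset.sum_congr rfl fun π _ => by rw [curl_add_period hW hZ]) y₀ hr
  have hd : dirSq Z (Finset.Icc y₀ (y₀ + fun _ => (r : ℤ))) ≤ dirSq Z (periodBox (d := d) P) := by
    unfold dirSq
    exact sum_Icc_le_sum_periodBox hP (fun x => Finset.sum_nonneg fun _ _ => sq_nonneg _)
      (fun x κ => Finset.sum_congr rfl fun μ _ => by rw [hZ x κ μ]) y₀ hr
  have h0 : 0 ≤ (((L : ℝ) ^ k)⁻¹) ^ 2 := sq_nonneg _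
  nlinarith

/-- **POINTWISE BOUND ON `Z` EVERYWHERE ON THE TORUS**: `P`-periodic `W`, `Z`; `Z(·, κ)` step-Lipschitz `λ ≥ 0`; `L ≥ 1`; any cube side
`r` with `r + 1 ≤ P`: `‖Z x₀ κ‖ ≤ 2d·r·λ + L^k·energyNormW L k W Z (periodBox P) ∕ √((r+1)^d)` for EVERY `x₀`. [folklore] -/
theorem norm_dir_le_of_energyNormW_periodic {L : ℕ} (hL : 1 ≤ L) (k : ℕ) {P : ℕ} (hP : 1 ≤ P)
    {W : Site d → Fin d → (Matrix n n ℂ)ˣ} {Z : Site d → Fin d → Matrix n n ℂ} (hW : IsPeriodicCfg W (P : ℤ))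
    (hZ : IsPeriodicDir Z (P : ℤ)) (κ : Fin d) {lam : ℝ} (hlam : 0 ≤ lam)
    (hlip : ∀ (x : Site d) (μ : Fin d), ‖Z (x + e μ) κ - Z x κ‖ ≤ lam) (x₀ : Site d) {r : ℕ} (hr : r + 1 ≤ P) :
    ‖Z x₀ κ‖ ≤ 2 * d * r * lam + (L : ℝ) ^ k * energyNormW L k W Z (periodBox (d := d) P) / Real.sqrt (((r : ℝ) + 1) ^ d) := by
  have hx₀ : x₀ ∈ Finset.Icc x₀ (x₀ + fun _ => (r : ℤ)) := by
    rw [Finset.mem_Icc]; exact ⟨le_rfl, fun μ => by simp⟩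
  have h1 := norm_dir_le_of_energyNormW hL k W Z κ hlam hlip (subset_refl _) hx₀
  have h2 := energyNormW_Icc_le_periodBox L k hP hW hZ x₀ hr
  have hpos : 0 < Real.sqrt (((r : ℝ) + 1) ^ d) := Real.sqrt_pos.mpr (by positivity)
  have hLk : 0 ≤ (L : ℝ) ^ k := pow_nonneg (Nat.cast_nonneg L) k
  have h3 := div_le_div_of_nonneg_right (mul_le_mul_of_nonneg_left h2 hLk) hpos.le
  linarith

/-- **POINTWISE BOUND ON THE DRESSED CURL EVERYWHERE ON THE TORUS** (same data; `λ′` a step-Lipschitz constant of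
`x ↦ (d_W Z)(x, π)`): `‖(d_W Z)(x₀, π)‖ ≤ 2d·r·λ′ + energyNormW L k W Z (periodBox P) ∕ √((r+1)^d)` for EVERY `x₀`. [folklore] -/
theorem norm_curl_le_of_energyNormW_periodic (L k : ℕ) {P : ℕ} (hP : 1 ≤ P)
    {W : Site d → Fin d → (Matrix n n ℂ)ˣ} {Z : Site d → Fin d → Matrix n n ℂ} (hW : IsPeriodicCfg W (P : ℤ))
    (hZ : IsPeriodicDir Z (P : ℤ)) (π : T4AveragingDeficitWall.Plane d) {lam : ℝ} (hlam : 0 ≤ lam)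
    (hlip : ∀ (x : Site d) (μ : Fin d), ‖curl W Z (x + e μ, π) - curl W Z (x, π)‖ ≤ lam) (x₀ : Site d) {r : ℕ}
    (hr : r + 1 ≤ P) :
    ‖curl W Z (x₀, π)‖ ≤ 2 * d * r * lam + energyNormW L k W Z (periodBox (d := d) P) / Real.sqrt (((r : ℝ) + 1) ^ d) := by
  have hx₀ : x₀ ∈ Finset.Icc x₀ (x₀ + fun _ => (r : ℤ)) := by
    rw [Finset.mem_Icc]; exact ⟨le_rfl, fun μ => by simp⟩
  have h1 := norm_curl_le_of_energyNormW L k W Z π hlam hlip (subset_refl _) hx₀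
  have h2 := energyNormW_Icc_le_periodBox L k hP hW hZ x₀ hr
  have hpos : 0 < Real.sqrt (((r : ℝ) + 1) ^ d) := Real.sqrt_pos.mpr (by positivity)
  have h3 := div_le_div_of_nonneg_right h2 hpos.le
  linarith

end Periodic

/-! ## §2 THE CUBE-SIDE OPTIMISATION AT `d = 4`, IN THE KERNEL: `a³·r + b³∕(r+1)² ≤ 2a²b` for a suitable `r`,
hence `sup ≤ 2a²b` with `a³ = 8λ′`, `b³ = E` — the rate `ξ^{2+1/3}` of the docstring made a theorem -/

section Optimise

/-- **THE TWO-TERM OPTIMISATION** (cube-root form, no real powers): for `a, b > 0` there is a natural `r` with `r + 1 < b∕a + 1` and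
`a³·r + b³∕(r+1)² ≤ 2·a²·b` (take `r + 1 = ⌈b∕a⌉`).  With `a³ = A`, `b³ = B` this is `A·r + B∕(r+1)² ≤ 2A^{2/3}B^{1/3}`. [folklore] -/
theorem exists_side_two_term {a b : ℝ} (ha : 0 < a) (hb : 0 < b) :
    ∃ r : ℕ, (r : ℝ) + 1 < b / a + 1 ∧ a ^ 3 * r + b ^ 3 / ((r : ℝ) + 1) ^ 2 ≤ 2 * a ^ 2 * b := by
  have hba : 0 < b / a := div_pos hb ha
  set m : ℕ := ⌈b / a⌉₊ with hm
  have hm1 : 1 ≤ m := Nat.one_le_iff_ne_zero.mpr (Nat.pos_iff_ne_zero.mp (Nat.ceil_pos.mpr hba))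
  refine ⟨m - 1, ?_, ?_⟩
  · have : ((m - 1 : ℕ) : ℝ) + 1 = (m : ℝ) := by
      rw [Nat.cast_sub hm1]; push_cast; ring
    rw [this]
    exact Nat.ceil_lt_add_one hba.le
  · have hcast : ((m - 1 : ℕ) : ℝ) + 1 = (m : ℝ) := by
      rw [Nat.cast_sub hm1]; push_cast; ring
    have hmge : b / a ≤ (m : ℝ) := Nat.le_ceil _
    have hrlt : ((m - 1 : ℕ) : ℝ) < b / a := by
      have := Nat.ceil_lt_add_one hba.le; rw [← hcast] at this; linarith
    -- first term: a³ r ≤ a³ (b/a) = a² b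
    have h1 : a ^ 3 * ((m - 1 : ℕ) : ℝ) ≤ a ^ 2 * b := by
      have : a ^ 3 * ((m - 1 : ℕ) : ℝ) ≤ a ^ 3 * (b / a) := mul_le_mul_of_nonneg_left hrlt.le (by positivity)
      calc a ^ 3 * ((m - 1 : ℕ) : ℝ) ≤ a ^ 3 * (b / a) := this
        _ = a ^ 2 * b := by field_simp
    -- second term: b³/(r+1)² ≤ b³/(b/a)² = a² b
    have hmpos : 0 < (m : ℝ) := by exact_mod_cast hm1
    have h2 : b ^ 3 / (((m - 1 : ℕ) : ℝ) + 1) ^ 2 ≤ a ^ 2 * b := by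
      rw [hcast]
      have hsq : (b / a) ^ 2 ≤ (m : ℝ) ^ 2 := pow_le_pow_left₀ hba.le hmge 2
      calc b ^ 3 / (m : ℝ) ^ 2 ≤ b ^ 3 / (b / a) ^ 2 :=
            div_le_div_of_nonneg_left (by positivity) (by positivity) hsq
        _ = a ^ 2 * b := by field_simp
    linarith

variable {n : Type*} [Fintype n] [DecidableEq n]

/-- `√((r+1)^4) = (r+1)²`. [folklore] -/
theorem sqrt_pow_four (r : ℕ) : Real.sqrt (((r : ℝ) + 1) ^ 4) = ((r : ℝ) + 1) ^ 2 := by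
  rw [show ((r : ℝ) + 1) ^ 4 = (((r : ℝ) + 1) ^ 2) ^ 2 by ring, Real.sqrt_sq (by positivity)]

/-- **THE OPTIMISED POINTWISE BOUND ON THE DRESSED CURL AT `d = 4`**: `P`-periodic `W`, `Z` on `ℤ⁴`; `λ′ > 0` a step-Lipschitz constant of
`(d_W Z)(·, π)`; `E = energyNormW L k W Z (periodBox P) > 0`; write `a³ = 8λ′`, `b³ = E` (`a, b > 0`).  If the optimal cube fits,
`b∕a + 1 ≤ P`, then `‖(d_W Z)(x₀, π)‖ ≤ 2·a²·b` for EVERY `x₀` — i.e. `sup ≤ 2·(8λ′)^{2/3}·E^{1/3}`; with `λ′ = Λ₂ξ³`, `E ≈ cN²√g·ξ`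
this is `≲ ξ^{2+1/3}` against the (1.15) margin `βα₀(g_k)ξ²`. [folklore] -/
theorem norm_curl_le_opt_d4 (L k : ℕ) {P : ℕ} (hP : 1 ≤ P)
    {W : Site 4 → Fin 4 → (Matrix n n ℂ)ˣ} {Z : Site 4 → Fin 4 → Matrix n n ℂ} (hW : IsPeriodicCfg W (P : ℤ))
    (hZ : IsPeriodicDir Z (P : ℤ)) (π : T4AveragingDeficitWall.Plane 4) {lam : ℝ}
    (hlip : ∀ (x : Site 4) (μ : Fin 4), ‖curl W Z (x + e μ, π) - curl W Z (x, π)‖ ≤ lam)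
    {a b : ℝ} (ha : 0 < a) (hb : 0 < b) (ha3 : a ^ 3 = 8 * lam)
    (hb3 : b ^ 3 = energyNormW L k W Z (periodBox (d := 4) P)) (hfit : b / a + 1 ≤ P) (x₀ : Site 4) :
    ‖curl W Z (x₀, π)‖ ≤ 2 * a ^ 2 * b := by
  obtain ⟨r, hr1, hr2⟩ := exists_side_two_term ha hb
  have hlam : 0 ≤ lam := by have := pow_pos ha 3; linarith
  have hrP : r + 1 ≤ P := by
    have : (r : ℝ) + 1 < (P : ℝ) := lt_of_lt_of_le hr1 hfit
    exact_mod_cast this.le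
  have h := norm_curl_le_of_energyNormW_periodic L k hP hW hZ π hlam hlip x₀ hrP
  rw [sqrt_pow_four] at h
  have e1 : (2 : ℝ) * (4 : ℕ) * r * lam = a ^ 3 * r := by rw [ha3]; push_cast; ring
  rw [e1, ← hb3] at h
  exact h.trans hr2

/-- **THE OPTIMISED POINTWISE BOUND ON `Z` AT `d = 4`**: same with `a³ = 8λ` (`λ` a step-Lipschitz constant of `Z(·, κ)`) and
`b³ = L^k·E`: `‖Z x₀ κ‖ ≤ 2·a²·b` for every `x₀` when `b∕a + 1 ≤ P` (`L ≥ 1`); with `λ = Λ₁ξ²`, `L^k·E ≈ cN²√g` this is `≲ ξ^{4/3}`.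
[folklore] -/
theorem norm_dir_le_opt_d4 {L : ℕ} (hL : 1 ≤ L) (k : ℕ) {P : ℕ} (hP : 1 ≤ P)
    {W : Site 4 → Fin 4 → (Matrix n n ℂ)ˣ} {Z : Site 4 → Fin 4 → Matrix n n ℂ} (hW : IsPeriodicCfg W (P : ℤ))
    (hZ : IsPeriodicDir Z (P : ℤ)) (κ : Fin 4) {lam : ℝ}
    (hlip : ∀ (x : Site 4) (μ : Fin 4), ‖Z (x + e μ) κ - Z x κ‖ ≤ lam)
    {a b : ℝ} (ha : 0 < a) (hb : 0 < b) (ha3 : a ^ 3 = 8 * lam)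
    (hb3 : b ^ 3 = (L : ℝ) ^ k * energyNormW L k W Z (periodBox (d := 4) P)) (hfit : b / a + 1 ≤ P) (x₀ : Site 4) :
    ‖Z x₀ κ‖ ≤ 2 * a ^ 2 * b := by
  obtain ⟨r, hr1, hr2⟩ := exists_side_two_term ha hb
  have hlam : 0 ≤ lam := by have := pow_pos ha 3; linarith
  have hrP : r + 1 ≤ P := by
    have : (r : ℝ) + 1 < (P : ℝ) := lt_of_lt_of_le hr1 hfit
    exact_mod_cast this.le
  have h := norm_dir_le_of_energyNormW_periodic hL k hP hW hZ κ hlam hlip x₀ hrP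
  rw [sqrt_pow_four] at h
  have e1 : (2 : ℝ) * (4 : ℕ) * r * lam = a ^ 3 * r := by rw [ha3]; push_cast; ring
  rw [e1, ← hb3] at h
  exact h.trans hr2

end Optimise

end

end Summit.QuantumFields.BalabanUV.T4Continuum.NE7EtaSupFromEnergyTorus
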